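import Literature.Computability.AlgebraicComplexity.ConstantFreeValiant
import Literature.Computability.AlgebraicComplexity.PBoundedGrowth
import Literature.Computability.AlgebraicComplexity.Bur24LiptonStockmeyerExample
import HarnessLib

/-!
# The unbounded-degree constant-free classes `VPnb⁰`, `VNPnb⁰` (Bürgisser 2024 survey, Def. 4.4)
# and the example `(X+1)^{2^n} ∈ VPnb⁰ ∖ VP⁰`

P. Bürgisser, *Completeness classes in algebraic complexity theory* (arXiv:2406.06217, 2024),
§4.2 (held text `paper:arxiv-2406.06217`, p0015 L100–L109, p0016 L1–L6):

> If we remove in Definition 4.2 the assumption of the multiplicative disjointness, the resulting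
> complexity class is denoted `VPnb⁰` and was first defined and investigated by Malod.
> **Definition 4.4.** The complexity class `VPnb⁰` is defined as the set of sequences `(f_n)` of
> multivariate polynomials such that there exists a sequence `(Φ_n)` of constant-free arithmetic
> circuits such that `Φ_n` computes `f_n` and the size `|Φ_n|` is bounded by a polynomial in `n`.
> The complexity class `VNPnb⁰` is defined via exponential summation as in Definition 2.25,
> requiring only `(g_n) ∈ VPnb⁰`.
> The sequences `(f_n)` in the classes `VPnb⁰` and `VNPnb⁰` consist of integer polynomials and the
> subscript "nb" stands for non-bounded degree. An important difference to `VP⁰, VNP⁰` is that the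
> degree and the bit size of `f_n` may be exponentially growing in `n`. For instance, the sequence
> `(X+1)^{2^n} = Σ_i binom(2^n, i) X^i` is in `VPnb⁰`.

Rendering: exactly the tree's `IsVP0Family` / `IsVNP0Family` (`ConstantFreeValiant.lean`: integer
polynomials, fan-in-two circuits with constants and sum coefficients in `{0, 1, -1}`
(`HasSignConstants`), p-bounded size, p-bounded number of variables) with the formal-degree
clause REMOVED (the survey's Def. 4.2 bounds the degree through multiplicative disjointness;
the tree's `VP⁰` through the formal degree — Bürgisser 2009, Def. 2.7 — the two agree, cf.
`MultiplicativelyDisjointSimulation.lean`). Two definitions, the rest theorems; no named facts.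

* `IsVPnb0Family` — **Def. 4.4, `VPnb⁰`**; `IsVNPnb0Family` — **Def. 4.4, `VNPnb⁰`**;
* `IsVP0Family.isVPnb0Family` (`VP⁰ ⊆ VPnb⁰`), `IsVNP0Family.isVNPnb0Family` (`VNP⁰ ⊆ VNPnb⁰`),
  `IsVPnb0Family.rename`, `IsVPnb0Family.isVNPnb0Family` (`VPnb⁰ ⊆ VNPnb⁰`),
  `IsVPnb0Family.isPBounded_constantFreeComplexity` and
  `isVPnb0Family_iff_isPBounded_constantFreeComplexity` (`(f_n) ∈ VPnb⁰ ⟺ τ(f_n)` and the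
  number of variables are p-bounded — `τ` is attained over `ℤ`);
* `totalDegree_X_add_one_pow`, `isVPnb0Family_X_add_one_pow_two_pow` (**the example
  `(X+1)^{2^n} ∈ VPnb⁰`**, from `Bur24_sec4_2_constantFreeComplexity_X_add_one_pow_two_pow_le`:
  `τ ≤ n + 1` by repeated squaring), `not_isVP0Family_X_add_one_pow_two_pow` (its degree `2^n` is
  not p-bounded, so it is NOT in `VP⁰`), `Bur24_sec4_2_vp0_ne_vpnb0` (`VP⁰ ⊊ VPnb⁰`: "the degree …
  may be exponentially growing").

Not formalised here: Rem. 4.5 (`VPnb^{𝔽_2} = P/poly`), the `VPnb⁰`-completeness of the generic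
computation `(G_n)` and Thms. 4.6–4.10 (Malod 2007, Koiran–Perifel) — they need these two
definitions and are left to successors.

## References

* [Burgisser2024Completeness] P. Bürgisser, arXiv:2406.06217 (2024), Def. 4.4 and §4.2
  (p0015 L100–L109, p0016 L1–L6).
* [Burgisser2006] P. Bürgisser, *On defining integers and proving arithmetic circuit lower
  bounds*, Comput. Complexity 18 (2009), Defs. 2.7–2.8 (the tree's `VP⁰`, `VNP⁰`).
* G. Malod, *The complexity of polynomials and their coefficient functions*, CCC 2007 (the
  survey's [malod:07]; origin of `VPnb⁰`).
-/

noncomputable section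

open MvPolynomial

namespace Literature.Computability.AlgebraicComplexity

universe v w

section Classes

variable {σ : ℕ → Type v} {τ : ℕ → Type w} [∀ n, Fintype (σ n)] [∀ n, Fintype (τ n)]

/-- **Bürgisser 2024, Def. 4.4: the class `VPnb⁰`** ("nb" = non-bounded degree). A family
`f = (f_n)` of integer polynomials is in `VPnb⁰` iff it is computed by a sequence of fan-in-two
constant-free (`HasSignConstants`) arithmetic circuits of p-bounded size — the tree's `IsVP0Family`
without the formal-degree bound; as for all families of the tree, the number of variables
`#σ n` is p-bounded. [cite: Burgisser2024Completeness, Def. 4.4 (p0015 L104–L109)] -/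
def IsVPnb0Family (f : ∀ n, MvPolynomial (σ n) ℤ) : Prop :=
  IsPBounded (fun n => Fintype.card (σ n)) ∧
    ∃ C : ∀ n, ArithCircuit ℤ (σ n),
      (∀ n, (C n).IsFanInTwo ∧ (C n).HasSignConstants ∧ (C n).Computes (f n)) ∧
        IsPBounded fun n => (C n).size

/-- **Bürgisser 2024, Def. 4.4: the class `VNPnb⁰`**, "defined via exponential summation as in
Definition 2.25, requiring only `(g_n) ∈ VPnb⁰`": `f_n(X) = Σ_{e ∈ {0,1}^{u n}} g_n(X, e)`
(`boolSum`) for some `g ∈ VPnb⁰` in the variables `σ n ⊕ Fin (u n)` (the tree's `IsVNP0Family` with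
`VPnb⁰` in place of `VP⁰`). [cite: Burgisser2024Completeness, Def. 4.4 (p0015 L108–L109)] -/
def IsVNPnb0Family (f : ∀ n, MvPolynomial (σ n) ℤ) : Prop :=
  ∃ (u : ℕ → ℕ) (g : ∀ n, MvPolynomial (σ n ⊕ Fin (u n)) ℤ),
    IsVPnb0Family g ∧ ∀ n, f n = boolSum (g n)

/-- `VP⁰ ⊆ VPnb⁰` (drop the formal-degree bound). [cite: Burgisser2024Completeness, §4.2 (p0015 L100–L103)] -/
theorem IsVP0Family.isVPnb0Family {f : ∀ n, MvPolynomial (σ n) ℤ} (hf : IsVP0Family f) :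
    IsVPnb0Family f := by
  obtain ⟨hcard, C, hC, hsize, -⟩ := hf
  exact ⟨hcard, C, hC, hsize⟩

/-- `VNP⁰ ⊆ VNPnb⁰`. [cite: Burgisser2024Completeness, §4.2 (p0015 L100–L109)] -/
theorem IsVNP0Family.isVNPnb0Family {f : ∀ n, MvPolynomial (σ n) ℤ} (hf : IsVNP0Family f) :
    IsVNPnb0Family f := by
  obtain ⟨u, g, hg, hfg⟩ := hf
  exact ⟨u, g, hg.isVPnb0Family, hfg⟩

/-- "if `(f_n) ∈ VPnb⁰` then `τ(f_n) = n^{O(1)}`": the circuits witnessing `VPnb⁰` bound the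
constant-free complexity `τ`. [cite: Burgisser2024Completeness, Def. 4.4 (p0015 L104–L107)] -/
theorem IsVPnb0Family.isPBounded_constantFreeComplexity {f : ∀ n, MvPolynomial (σ n) ℤ}
    (hf : IsVPnb0Family f) : IsPBounded fun n => constantFreeComplexity (f n) := by
  obtain ⟨-, C, hC, hsize⟩ := hf
  exact hsize.mono fun n =>
    ArithCircuit.constantFreeComplexity_le_size (hC n).1 (hC n).2.1 (hC n).2.2

/-- **`(f_n) ∈ VPnb⁰ ⟺` the number of variables and `τ(f_n)` are p-bounded** (`τ` is attained
over `ℤ`, `ArithCircuit.exists_computes_size_eq_constantFreeComplexity`).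
[cite: Burgisser2024Completeness, Def. 4.4 (p0015 L104–L107)] -/
theorem isVPnb0Family_iff_isPBounded_constantFreeComplexity (f : ∀ n, MvPolynomial (σ n) ℤ) :
    IsVPnb0Family f ↔ IsPBounded (fun n => Fintype.card (σ n)) ∧
      IsPBounded fun n => constantFreeComplexity (f n) := by
  refine ⟨fun hf => ⟨hf.1, hf.isPBounded_constantFreeComplexity⟩, fun ⟨hcard, hτ⟩ => ?_⟩
  choose C hC using fun n => ArithCircuit.exists_computes_size_eq_constantFreeComplexity (f n)
  exact ⟨hcard, C, fun n => ⟨(hC n).1, (hC n).2.1, (hC n).2.2.1⟩,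
    hτ.mono fun n => ((hC n).2.2.2).le⟩

/-- `VPnb⁰` is stable under renamings into p-bounded variable types (rename the circuits).
[cite: Burgisser2024Completeness, Def. 4.4 (p0015 L104–L107)] -/
theorem IsVPnb0Family.rename {f : ∀ n, MvPolynomial (σ n) ℤ} (hf : IsVPnb0Family f)
    (e : ∀ n, σ n → τ n) (hτ : IsPBounded fun n => Fintype.card (τ n)) :
    IsVPnb0Family fun n => MvPolynomial.rename (e n) (f n) := by
  obtain ⟨-, C, hC, hsize⟩ := hf
  refine ⟨hτ, fun n => (C n).rename (e n), fun n => ⟨(hC n).1.rename _, (hC n).2.1.rename _,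
    (hC n).2.2.rename _⟩, ?_⟩
  simpa using hsize

/-- **`VPnb⁰ ⊆ VNPnb⁰`** (empty Boolean sum, `u = 0`). [cite: Burgisser2024Completeness, Def. 4.4 (p0015 L108–L109)] -/
theorem IsVPnb0Family.isVNPnb0Family {f : ∀ n, MvPolynomial (σ n) ℤ} (hf : IsVPnb0Family f) :
    IsVNPnb0Family f := by
  refine ⟨fun _ => 0, fun n => MvPolynomial.rename Sum.inl (f n), hf.rename _ ?_, fun n => ?_⟩
  · exact hf.1.mono fun n => by simp [Fintype.card_sum]
  · simp only [boolSum]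
    rw [Fintype.sum_unique, MvPolynomial.aeval_rename]
    simp [Function.comp_def]

end Classes

/-! ## The example `(X+1)^{2^n}`: in `VPnb⁰`, of degree `2^n`, hence not in `VP⁰` -/

section Example

/-- `deg (X+1)^m = m` over `ℤ` (total degree is additive on products over a domain).
[cite: Burgisser2024Completeness, §4.2 (p0016 L3–L6)] -/
theorem totalDegree_X_add_one_pow (m : ℕ) :
    (((X 0 : MvPolynomial (Fin 1) ℤ) + 1) ^ m).totalDegree = m := by
  have h1 : ((X 0 : MvPolynomial (Fin 1) ℤ) + 1).totalDegree = 1 := by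
    rw [totalDegree_add_eq_left_of_totalDegree_lt] <;> simp [totalDegree_X]
  have h0 : ((X 0 : MvPolynomial (Fin 1) ℤ) + 1) ≠ 0 := fun h => by
    rw [h, totalDegree_zero] at h1; exact zero_ne_one h1
  induction m with
  | zero => simp
  | succ m ih => rw [pow_succ, totalDegree_mul_of_isDomain (pow_ne_zero m h0) h0, ih, h1]

/-- **Bürgisser 2024, §4.2: "the sequence `(X+1)^{2^n} = Σ_i binom(2^n, i) X^i` is in `VPnb⁰`"**
(one variable; `τ((X+1)^{2^n}) ≤ n + 1` by repeated squaring,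
`Bur24_sec4_2_constantFreeComplexity_X_add_one_pow_two_pow_le`).
[cite: Burgisser2024Completeness, §4.2 (p0016 L5–L6)] -/
theorem isVPnb0Family_X_add_one_pow_two_pow :
    IsVPnb0Family fun n => ((X 0 : MvPolynomial (Fin 1) ℤ) + 1) ^ 2 ^ n := by
  refine (isVPnb0Family_iff_isPBounded_constantFreeComplexity _).2 ⟨⟨1, fun _ => by simp⟩,
    ⟨1, fun n => ?_⟩⟩
  simpa using Bur24_sec4_2_constantFreeComplexity_X_add_one_pow_two_pow_le (k := ℤ) (0 : Fin 1) n

/-- **… but not in `VP⁰`**: its degree `2^n` is not p-bounded ("the degree … of `f_n` may be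
exponentially growing in `n`"), while `VP⁰` families are p-families (`IsVP0Family.isPFamily`).
[cite: Burgisser2024Completeness, §4.2 (p0016 L3–L6)] -/
theorem not_isVP0Family_X_add_one_pow_two_pow :
    ¬ IsVP0Family fun n => ((X 0 : MvPolynomial (Fin 1) ℤ) + 1) ^ 2 ^ n := by
  intro h
  have hdeg := h.isPFamily.2
  simp only [totalDegree_X_add_one_pow] at hdeg
  exact not_isPBounded_two_pow hdeg

/-- **`VP⁰ ⊊ VPnb⁰`** (Bürgisser 2024, §4.2: "An important difference to `VP⁰, VNP⁰` is that the
degree and the bit size of `f_n` may be exponentially growing in `n`"): the inclusion, and the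
witness `(X+1)^{2^n}` of strictness. [cite: Burgisser2024Completeness, §4.2 (p0016 L3–L6)] -/
theorem Bur24_sec4_2_vp0_ssubset_vpnb0 :
    (∀ {σ : ℕ → Type v} [∀ n, Fintype (σ n)] (f : ∀ n, MvPolynomial (σ n) ℤ),
        IsVP0Family f → IsVPnb0Family f) ∧
      ∃ f : ℕ → MvPolynomial (Fin 1) ℤ, IsVPnb0Family f ∧ ¬ IsVP0Family f :=
  ⟨fun _ hf => hf.isVPnb0Family,
    ⟨_, isVPnb0Family_X_add_one_pow_two_pow, not_isVP0Family_X_add_one_pow_two_pow⟩⟩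

end Example

end Literature.Computability.AlgebraicComplexity

end
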